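/-
Copyright (c) 2026 the pub-hodgecm-mathlib formalisation cell (harness21).  Prover seat hodgecm-mathlib-LH4-p02 (g8), on JAC-loc road holder LH6-p03 (g5)'s NAME
(2026-09-02T14:20:37Z): brick (L5) «COMMUTATOR LEVEL ESTIMATE» of `F0/P3b/LH6-p03/g5/ROAD-JAC-LOC.v1.LH6p03g5.md` §2 (J2).
-/
import Literature.NumberTheory.Automorphic.CongruenceSubgroupExpansionGL   -- ★ `conj_mem_congruenceGL` (normality in `GL_n(𝒪)`), `valBound_one_of_mem_glInt`; brings ★ `GLnCongruenceSubgroups` (`ValBound`, `congruenceGL`)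
import Mathlib.GroupTheory.Commutator.Basic
import HarnessLib

/-!
# Commutators of principal congruence subgroups of `GL_n(F)`: `⁅K_γ, K_γ'⁆ ⊆ K_{γγ'}`, normality `K_γ' ⊴ K_γ ⊴ GL_n(𝒪)`, the second-order expansions of
# products, inverses and commutators near `1`, and transport along any `G →* GL_n(F)` (Casselman 1995 §1.4; Bernstein–Zelevinsky 1976 §3)

Topic `NumberTheory/Automorphic`; namespace `Literature.NumberTheory.Automorphic`.  THEOREMS ONLY (no definition, no instance, no notation, no named fact, no `sorry`;
axioms ⊆ {propext, Classical.choice, Quot.sound}).  Cell `pub/hodgecm-mathlib` (D-0151), crux H413 = `stmt-HodgeConjecture-24833`; half A line LH6 (closer stub `stub_StCharTS`, leaf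
`Cruxes/H413/Lines/F0_P3c_StCharTSPaydown.lean`, organ (S-𝔇) `stub_EllipticPackage`), road «JAC-LOC» v1 (LH6-p03 (g5), sha16 1baf945b39c9bc56) §2 brick **(L5)**: the level
bookkeeping that (J4) «ORBIT ⊆ + GROUP + INDEX» (refactorisation of `K_γ^{(s)}` through a deeper level) and (J5b) «NEWTON STEP» (quadratic error of the linearised conjugation
equation) consume.  Lane `--kind proof --supports stmt-HodgeConjecture-24833`; count-neutral.  HONEST LABEL: HC_CM is proved only modulo the 7 printed citations (2 remaining
named inputs: hLiu418 = stmt-HodgeConjecture-24832, h413 = stmt-HodgeConjecture-24833) until rung 0 closes; generic matrix algebra over a field with a `ValuativeRel`.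

SETTING (= ★ `GLnCongruenceSubgroups`).  `F` a field with a `ValuativeRel` (`v = valuation F`), `ValBound γ M` = «every entry of `M` has `v ≤ γ`», `K_γ := congruenceGL n γ ≤ GL_n(F)`
= {`g`, `g⁻¹` integral, `g − 1` and `g⁻¹ − 1` with entries `≤ γ`}, `GL_n(𝒪) = glInt n F`.  NO size hypothesis on the levels anywhere (`γ, γ' : ValueGroupWithZero F` arbitrary):
integrality is part of membership, so the estimates hold verbatim for `γ ≥ 1` (where `K_γ = GL_n(𝒪)`).

* §1 MATRIX ALGEBRA NEAR `1` (any square index type).  `valBound_mul_sub_mul`: `M ≡ 1 (γ)`, `N ≡ 1 (γ')` ⇒ `MN − NM = (M−1)(N−1) − (N−1)(M−1)` has entries `≤ γγ'`;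
  `valBound_mul_sub_one_sub_add`: `MN − 1 − ((M−1) + (N−1)) = (M−1)(N−1)` has entries `≤ γγ'` (products are ADDITIVE to second order).
* §2 IN `GL_n`.  `valBound_coe_inv_sub_one_add` : for `k ∈ K_γ`, `k⁻¹ − 1 + (k − 1) = k⁻¹(k − 1)²` has entries `≤ γ²` (the inverse is `2 − k` to second order);
  **`commutator_mem_congruenceGL`**: `k ∈ K_γ`, `k' ∈ K_γ'` ⇒ `k k' k⁻¹ k'⁻¹ ∈ K_{γγ'}` (`c − 1 = (kk' − k'k)·k⁻¹k'⁻¹`, `c⁻¹ − 1 = (k'k − kk')·k'⁻¹k⁻¹`);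
  `valBound_coe_commutator_sub_one_sub`: `c − 1 − (XY − YX)` has entries `≤ γγ'·max γ γ'` (`X = k − 1`, `Y = k' − 1`: the commutator is `1 + [X, Y]` to THIRD order);
  `commutator_congruenceGL_le : ⁅K_γ, K_γ'⁆ ≤ K_{γγ'}` (Mathlib `Subgroup.commutator`).
* §3 NORMALITY PACKAGED.  ★ `conj_mem_congruenceGL` (every `K_γ` is normalised by ALL of `GL_n(𝒪)`) ⇒ `normal_congruenceGL_subgroupOf_glInt : (K_γ.subgroupOf GL_n(𝒪)).Normal` and, for
  `γ' ≤ γ`, `normal_congruenceGL_subgroupOf_congruenceGL : (K_γ'.subgroupOf K_γ).Normal` (the road's «`γ′ ≤ γ < 1 → K_γ′ ⊴ K_γ`»; `< 1` is not needed).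
* §4 TRANSPORT along any `f : G →* GL_n(F)` (the model's `U′.subtype`, `U′ = U(Φ₃)(K)`, so `K_γ ∩ U′ = K_γ.comap U′.subtype` of ★ `UnitaryGroupRankOneIwahoriDatum`):
  `commutator_mem_comap_congruenceGL`, `commutator_comap_congruenceGL_le : ⁅K_γ.comap f, K_γ'.comap f⁆ ≤ K_{γγ'}.comap f`, `conj_mem_comap_congruenceGL_of_mem_comap_glInt`,
  `normal_comap_congruenceGL_subgroupOf_comap_glInt`, `normal_comap_congruenceGL_subgroupOf (γ' ≤ γ)`.

## References
* [Casselman1995] W. Casselman, *Introduction to the theory of admissible representations of p-adic reductive groups* (draft 1995), §1.4 Prop. 1.4.4 (the `K_m` are normal in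
  `K₀` with `⁅K_a, K_b⁆ ⊆ K_{a+b}`).
* [BernsteinZelevinsky1976] I. N. Bernstein, A. V. Zelevinsky, *Representations of the group GL(n, F) where F is a non-archimedean local field*, Russian Math. Surveys 31:3 (1976), §3.
* [Rogawski1990] J. D. Rogawski, *Automorphic Representations of Unitary Groups in Three Variables* (1990), §12.5 p. 182 (the Weyl integration formula whose local tube Jacobian this
  road computes).
-/

set_option autoImplicit false

noncomputable section

open scoped MatrixGroups
open Matrix ValuativeRel

namespace Literature.NumberTheory.Automorphic

/-! ## §1 Matrix algebra near `1` -/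

section MatrixAlgebra

variable {F : Type*} [Field F] [ValuativeRel F] {m : Type*} [Fintype m] [DecidableEq m]

/-- `MN − NM = (M − 1)(N − 1) − (N − 1)(M − 1)`; hence `M ≡ 1 (γ)`, `N ≡ 1 (γ')` ⇒ the entries of `MN − NM` are `≤ γγ'`. [cite: Casselman1995, §1.4 Prop. 1.4.4] -/
theorem valBound_mul_sub_mul {γ γ' : ValueGroupWithZero F} {M N : Matrix m m F} (hM : ValBound γ (M - 1)) (hN : ValBound γ' (N - 1)) :
    ValBound (γ * γ') (M * N - N * M) := by
  have e : M * N - N * M = (M - 1) * (N - 1) - (N - 1) * (M - 1) := by noncomm_ring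
  rw [e]
  have h2 := hN.mul hM
  rw [mul_comm γ' γ] at h2
  exact (hM.mul hN).sub h2

/-- `MN − 1 − ((M − 1) + (N − 1)) = (M − 1)(N − 1)`: to second order, products near `1` are ADDITIVE; entries `≤ γγ'`. [cite: Casselman1995, §1.4 Prop. 1.4.4] -/
theorem valBound_mul_sub_one_sub_add {γ γ' : ValueGroupWithZero F} {M N : Matrix m m F} (hM : ValBound γ (M - 1)) (hN : ValBound γ' (N - 1)) :
    ValBound (γ * γ') (M * N - 1 - ((M - 1) + (N - 1))) := by
  have e : M * N - 1 - ((M - 1) + (N - 1)) = (M - 1) * (N - 1) := by noncomm_ring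
  rw [e]
  exact hM.mul hN

end MatrixAlgebra

/-! ## §2 Commutators in the principal congruence subgroups of `GL_n(F)` -/

section Congruence

variable {F : Type*} [Field F] [ValuativeRel F] {n : ℕ}

omit [ValuativeRel F] in
/-- `k · k⁻¹ = 1` as matrices. [folklore] -/
private theorem glCoe_mul_glCoe_inv (k : GL (Fin n) F) :
    (k : Matrix (Fin n) (Fin n) F) * ((k⁻¹ : GL (Fin n) F) : Matrix (Fin n) (Fin n) F) = 1 := by
  rw [← Units.val_mul, mul_inv_cancel, Units.val_one]

omit [ValuativeRel F] in
/-- `k⁻¹ · k = 1` as matrices. [folklore] -/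
private theorem glCoe_inv_mul_glCoe (k : GL (Fin n) F) :
    ((k⁻¹ : GL (Fin n) F) : Matrix (Fin n) (Fin n) F) * (k : Matrix (Fin n) (Fin n) F) = 1 := by
  rw [← Units.val_mul, inv_mul_cancel, Units.val_one]

/-- **THE INVERSE TO SECOND ORDER**: for `k ∈ K_γ`, `k⁻¹ − 1 + (k − 1) = k⁻¹ (k − 1)²` has entries `≤ γ²` — i.e. `k⁻¹ ≡ 2 − k` modulo `γ²`. [cite: Casselman1995, §1.4 Prop. 1.4.4] -/
theorem valBound_coe_inv_sub_one_add {γ : ValueGroupWithZero F} {k : GL (Fin n) F} (hk : k ∈ congruenceGL n γ) :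
    ValBound (γ * γ) ((((k⁻¹ : GL (Fin n) F) : Matrix (Fin n) (Fin n) F) - 1) + ((k : Matrix (Fin n) (Fin n) F) - 1)) := by
  have e : (((k⁻¹ : GL (Fin n) F) : Matrix (Fin n) (Fin n) F) - 1) + ((k : Matrix (Fin n) (Fin n) F) - 1) =
      ((k⁻¹ : GL (Fin n) F) : Matrix (Fin n) (Fin n) F) * (((k : Matrix (Fin n) (Fin n) F) - 1) * ((k : Matrix (Fin n) (Fin n) F) - 1)) := by
    rw [Matrix.sub_mul, Matrix.mul_sub, Matrix.mul_sub, Matrix.one_mul, Matrix.mul_one, Matrix.mul_sub, Matrix.mul_sub, Matrix.mul_one,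
      ← Matrix.mul_assoc, glCoe_inv_mul_glCoe, Matrix.one_mul]
    abel
  rw [e]
  have h := hk.1.2.mul (hk.2.1.mul hk.2.1)
  rwa [one_mul] at h

/-- **(L5) THE COMMUTATOR LEVEL ESTIMATE**: `k ∈ K_γ`, `k' ∈ K_γ'` ⇒ `k k' k⁻¹ k'⁻¹ ∈ K_{γγ'}` — with `X = k − 1`, `Y = k' − 1`: `c − 1 = (kk' − k'k)·k⁻¹k'⁻¹ = (XY − YX)·k⁻¹k'⁻¹`
and `c⁻¹ − 1 = (YX − XY)·k'⁻¹k⁻¹`, the inverses being integral by membership.  No hypothesis on `γ, γ'`. [cite: Casselman1995, §1.4 Prop. 1.4.4]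
[cite: BernsteinZelevinsky1976, §3] -/
theorem commutator_mem_congruenceGL {γ γ' : ValueGroupWithZero F} {k k' : GL (Fin n) F} (hk : k ∈ congruenceGL n γ) (hk' : k' ∈ congruenceGL n γ') :
    k * k' * k⁻¹ * k'⁻¹ ∈ congruenceGL n (γ * γ') := by
  obtain ⟨⟨hk1, hki1⟩, hkγ, hkiγ⟩ := hk
  obtain ⟨⟨hk'1, hk'i1⟩, hk'γ, hk'iγ⟩ := hk'
  -- the two expansions `c − 1 = (kk' − k'k) k⁻¹ k'⁻¹`, `c⁻¹ − 1 = (k'k − kk') k'⁻¹ k⁻¹`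
  have e1 : ((k * k' * k⁻¹ * k'⁻¹ : GL (Fin n) F) : Matrix (Fin n) (Fin n) F) - 1 =
      ((k : Matrix (Fin n) (Fin n) F) * (k' : Matrix (Fin n) (Fin n) F) - (k' : Matrix (Fin n) (Fin n) F) * (k : Matrix (Fin n) (Fin n) F)) *
        ((k⁻¹ : GL (Fin n) F) : Matrix (Fin n) (Fin n) F) * ((k'⁻¹ : GL (Fin n) F) : Matrix (Fin n) (Fin n) F) := by
    rw [Units.val_mul, Units.val_mul, Units.val_mul, Matrix.sub_mul, Matrix.sub_mul,
      Matrix.mul_assoc (k' : Matrix (Fin n) (Fin n) F) (k : Matrix (Fin n) (Fin n) F), glCoe_mul_glCoe_inv, Matrix.mul_one, glCoe_mul_glCoe_inv]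
  have e2 : (((k * k' * k⁻¹ * k'⁻¹)⁻¹ : GL (Fin n) F) : Matrix (Fin n) (Fin n) F) - 1 =
      ((k' : Matrix (Fin n) (Fin n) F) * (k : Matrix (Fin n) (Fin n) F) - (k : Matrix (Fin n) (Fin n) F) * (k' : Matrix (Fin n) (Fin n) F)) *
        ((k'⁻¹ : GL (Fin n) F) : Matrix (Fin n) (Fin n) F) * ((k⁻¹ : GL (Fin n) F) : Matrix (Fin n) (Fin n) F) := by
    rw [show (k * k' * k⁻¹ * k'⁻¹)⁻¹ = k' * k * k'⁻¹ * k⁻¹ by group, Units.val_mul, Units.val_mul, Units.val_mul, Matrix.sub_mul, Matrix.sub_mul,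
      Matrix.mul_assoc (k : Matrix (Fin n) (Fin n) F) (k' : Matrix (Fin n) (Fin n) F), glCoe_mul_glCoe_inv, Matrix.mul_one, glCoe_mul_glCoe_inv]
  refine ⟨⟨?_, ?_⟩, ?_, ?_⟩
  · rw [Units.val_mul, Units.val_mul, Units.val_mul]
    have h := ((hk1.mul hk'1).mul hki1).mul hk'i1
    rwa [one_mul, one_mul, one_mul] at h
  · rw [show (k * k' * k⁻¹ * k'⁻¹)⁻¹ = k' * k * k'⁻¹ * k⁻¹ by group, Units.val_mul, Units.val_mul, Units.val_mul]
    have h := ((hk'1.mul hk1).mul hk'i1).mul hki1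
    rwa [one_mul, one_mul, one_mul] at h
  · rw [e1]
    have h := ((valBound_mul_sub_mul hkγ hk'γ).mul hki1).mul hk'i1
    rwa [mul_one, mul_one] at h
  · rw [e2]
    have h := ((valBound_mul_sub_mul hk'γ hkγ).mul hk'i1).mul hki1
    rwa [mul_one, mul_one, mul_comm γ' γ] at h

/-- **THE COMMUTATOR TO THIRD ORDER**: for `k ∈ K_γ`, `k' ∈ K_γ'`, `X = k − 1`, `Y = k' − 1`: `k k' k⁻¹ k'⁻¹ − 1 − (XY − YX) = (XY − YX)(k⁻¹k'⁻¹ − 1)` has entries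
`≤ γγ'·max γ γ'` — the commutator is `1 + [X, Y]` up to third-order terms (the quadratic-error bookkeeping of a Newton step). [cite: Casselman1995, §1.4 Prop. 1.4.4] -/
theorem valBound_coe_commutator_sub_one_sub {γ γ' : ValueGroupWithZero F} {k k' : GL (Fin n) F} (hk : k ∈ congruenceGL n γ) (hk' : k' ∈ congruenceGL n γ') :
    ValBound (γ * γ' * max γ γ')
      ((((k * k' * k⁻¹ * k'⁻¹ : GL (Fin n) F) : Matrix (Fin n) (Fin n) F) - 1) -
        (((k : Matrix (Fin n) (Fin n) F) - 1) * ((k' : Matrix (Fin n) (Fin n) F) - 1) -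
          ((k' : Matrix (Fin n) (Fin n) F) - 1) * ((k : Matrix (Fin n) (Fin n) F) - 1))) := by
  obtain ⟨⟨hk1, hki1⟩, hkγ, hkiγ⟩ := hk
  obtain ⟨⟨hk'1, hk'i1⟩, hk'γ, hk'iγ⟩ := hk'
  have hcomm : (k : Matrix (Fin n) (Fin n) F) * (k' : Matrix (Fin n) (Fin n) F) - (k' : Matrix (Fin n) (Fin n) F) * (k : Matrix (Fin n) (Fin n) F) =
      ((k : Matrix (Fin n) (Fin n) F) - 1) * ((k' : Matrix (Fin n) (Fin n) F) - 1) - ((k' : Matrix (Fin n) (Fin n) F) - 1) * ((k : Matrix (Fin n) (Fin n) F) - 1) := by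
    noncomm_ring
  have e : (((k * k' * k⁻¹ * k'⁻¹ : GL (Fin n) F) : Matrix (Fin n) (Fin n) F) - 1) -
      (((k : Matrix (Fin n) (Fin n) F) - 1) * ((k' : Matrix (Fin n) (Fin n) F) - 1) - ((k' : Matrix (Fin n) (Fin n) F) - 1) * ((k : Matrix (Fin n) (Fin n) F) - 1)) =
      ((k : Matrix (Fin n) (Fin n) F) * (k' : Matrix (Fin n) (Fin n) F) - (k' : Matrix (Fin n) (Fin n) F) * (k : Matrix (Fin n) (Fin n) F)) *
        (((k⁻¹ : GL (Fin n) F) : Matrix (Fin n) (Fin n) F) * ((k'⁻¹ : GL (Fin n) F) : Matrix (Fin n) (Fin n) F) - 1) := by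
    rw [← hcomm, Matrix.mul_sub, Matrix.mul_one, ← Matrix.mul_assoc, Units.val_mul, Units.val_mul, Units.val_mul, Matrix.sub_mul, Matrix.sub_mul,
      Matrix.mul_assoc (k' : Matrix (Fin n) (Fin n) F) (k : Matrix (Fin n) (Fin n) F), glCoe_mul_glCoe_inv, Matrix.mul_one, glCoe_mul_glCoe_inv]
  rw [e]
  have hinv : ValBound (max γ γ') (((k⁻¹ : GL (Fin n) F) : Matrix (Fin n) (Fin n) F) * ((k'⁻¹ : GL (Fin n) F) : Matrix (Fin n) (Fin n) F) - 1) :=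
    (hkiγ.mono (le_max_left _ _)).mul_sub_one (hk'iγ.mono (le_max_right _ _)) hk'i1
  exact (valBound_mul_sub_mul hkγ hk'γ).mul hinv

/-- **`⁅K_γ, K_γ'⁆ ≤ K_{γγ'}`** as subgroups of `GL_n(F)` (Mathlib `Subgroup.commutator`). [cite: Casselman1995, §1.4 Prop. 1.4.4] [cite: BernsteinZelevinsky1976, §3] -/
theorem commutator_congruenceGL_le (γ γ' : ValueGroupWithZero F) :
    ⁅congruenceGL n γ, congruenceGL n γ'⁆ ≤ congruenceGL n (γ * γ') :=
  Subgroup.commutator_le.2 fun _ hk _ hk' => by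
    rw [commutatorElement_def]
    exact commutator_mem_congruenceGL hk hk'

/-- The symmetric reading `k' k k'⁻¹ k⁻¹ ∈ K_{γγ'}` (same estimate, levels commute). [cite: Casselman1995, §1.4 Prop. 1.4.4] -/
theorem commutator_mem_congruenceGL' {γ γ' : ValueGroupWithZero F} {k k' : GL (Fin n) F} (hk : k ∈ congruenceGL n γ) (hk' : k' ∈ congruenceGL n γ') :
    k' * k * k'⁻¹ * k⁻¹ ∈ congruenceGL n (γ * γ') := by
  rw [mul_comm γ γ']
  exact commutator_mem_congruenceGL hk' hk

/-- `k k' = (k k' k⁻¹ k'⁻¹) · (k' k)`: two elements of levels `γ, γ'` commute up to a factor in `K_{γγ'}` (`∃ c ∈ K_{γγ'}, k k' = c · k' k`). [cite: Casselman1995, §1.4 Prop. 1.4.4] -/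
theorem exists_mem_congruenceGL_mul_eq_mul {γ γ' : ValueGroupWithZero F} {k k' : GL (Fin n) F} (hk : k ∈ congruenceGL n γ) (hk' : k' ∈ congruenceGL n γ') :
    ∃ c ∈ congruenceGL n (γ * γ'), k * k' = c * (k' * k) :=
  ⟨k * k' * k⁻¹ * k'⁻¹, commutator_mem_congruenceGL hk hk', by group⟩

/-- `k k' k⁻¹ = k' · (k'⁻¹ k k' k⁻¹)`: conjugating a level-`γ'` element by a level-`γ` element moves it by a factor in `K_{γγ'}` ON THE RIGHT (`∃ c ∈ K_{γγ'}, k k' k⁻¹ = k' c`) — the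
shape «`kτk⁻¹ ∈ τ·⁅K_γ, K_γ⁆`» of the road's (J4c). [cite: Casselman1995, §1.4 Prop. 1.4.4] -/
theorem exists_mem_congruenceGL_conj_eq_mul {γ γ' : ValueGroupWithZero F} {k k' : GL (Fin n) F} (hk : k ∈ congruenceGL n γ) (hk' : k' ∈ congruenceGL n γ') :
    ∃ c ∈ congruenceGL n (γ * γ'), k * k' * k⁻¹ = k' * c := by
  refine ⟨k'⁻¹ * k * k' * k⁻¹, ?_, by group⟩
  have h := commutator_mem_congruenceGL ((congruenceGL n γ').inv_mem hk') hk
  rwa [inv_inv, mul_comm γ' γ] at h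

/-- Level arithmetic: `γγ' ≤ ε ⇒ ⁅K_γ, K_γ'⁆ ≤ K_ε`; with `γ = γ'` and `γ² ≤ ε` this is the ABELIAN condition «`K_γ ⧸ K_ε` is commutative» of the road's sandwich (J4a).
[cite: Casselman1995, §1.4 Prop. 1.4.4] -/
theorem commutator_congruenceGL_le_of_mul_le {γ γ' ε : ValueGroupWithZero F} (h : γ * γ' ≤ ε) :
    ⁅congruenceGL n γ, congruenceGL n γ'⁆ ≤ congruenceGL n ε :=
  (commutator_congruenceGL_le γ γ').trans (congruenceGL_mono h)

/-- Elementwise: `γγ' ≤ ε`, `k ∈ K_γ`, `k' ∈ K_γ'` ⇒ `k k' k⁻¹ k'⁻¹ ∈ K_ε`. [cite: Casselman1995, §1.4 Prop. 1.4.4] -/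
theorem commutator_mem_congruenceGL_of_mul_le {γ γ' ε : ValueGroupWithZero F} (h : γ * γ' ≤ ε) {k k' : GL (Fin n) F} (hk : k ∈ congruenceGL n γ)
    (hk' : k' ∈ congruenceGL n γ') : k * k' * k⁻¹ * k'⁻¹ ∈ congruenceGL n ε :=
  congruenceGL_mono h (commutator_mem_congruenceGL hk hk')

/-! ## §3 Normality packaged (★ `conj_mem_congruenceGL`: every level is normalised by all of `GL_n(𝒪)`) -/

/-- **`K_γ ⊴ GL_n(𝒪)`** as a `Subgroup.Normal` instance-free statement: `(K_γ.subgroupOf GL_n(𝒪)).Normal`. [cite: Casselman1995, §1.4 Prop. 1.4.4] [cite: BernsteinZelevinsky1976, §3] -/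
theorem normal_congruenceGL_subgroupOf_glInt (γ : ValueGroupWithZero F) : ((congruenceGL n γ).subgroupOf (glInt n F)).Normal :=
  (Subgroup.normal_subgroupOf_iff (congruenceGL_le_glInt γ)).2 fun _ _ hk hκ => conj_mem_congruenceGL hκ hk

/-- `κ ∈ K_γ`, `k ∈ K_γ'` ⇒ `κ k κ⁻¹ ∈ K_γ'` (any `γ, γ'`; `K_γ ≤ GL_n(𝒪)`). [cite: Casselman1995, §1.4 Prop. 1.4.4] -/
theorem conj_mem_congruenceGL_of_mem_congruenceGL {γ γ' : ValueGroupWithZero F} {κ k : GL (Fin n) F} (hκ : κ ∈ congruenceGL n γ) (hk : k ∈ congruenceGL n γ') :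
    κ * k * κ⁻¹ ∈ congruenceGL n γ' :=
  conj_mem_congruenceGL (congruenceGL_le_glInt γ hκ) hk

/-- **`K_γ' ⊴ K_γ` for `γ' ≤ γ`**: `(K_γ'.subgroupOf K_γ).Normal` (the road's «`γ′ ≤ γ < 1 → K_γ′ ⊴ K_γ`»; the bound `< 1` is not needed). [cite: Casselman1995, §1.4 Prop. 1.4.4] -/
theorem normal_congruenceGL_subgroupOf_congruenceGL {γ γ' : ValueGroupWithZero F} (h : γ' ≤ γ) :
    ((congruenceGL n γ').subgroupOf (congruenceGL n γ)).Normal :=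
  (Subgroup.normal_subgroupOf_iff (congruenceGL_mono h)).2 fun _ _ hk hκ => conj_mem_congruenceGL_of_mem_congruenceGL hκ hk

end Congruence

/-! ## §4 Transport along any `f : G →* GL_n(F)` (e.g. the inclusion of `U(Φ₃)(K)`) -/

section Transport

variable {F : Type*} [Field F] [ValuativeRel F] {n : ℕ} {G : Type*} [Group G] (f : G →* GL (Fin n) F)

/-- (L5) along `f`: `k ∈ K_γ.comap f`, `k' ∈ K_γ'.comap f` ⇒ `k k' k⁻¹ k'⁻¹ ∈ K_{γγ'}.comap f`. [cite: Casselman1995, §1.4 Prop. 1.4.4] -/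
theorem commutator_mem_comap_congruenceGL {γ γ' : ValueGroupWithZero F} {k k' : G} (hk : k ∈ (congruenceGL n γ).comap f)
    (hk' : k' ∈ (congruenceGL n γ').comap f) : k * k' * k⁻¹ * k'⁻¹ ∈ (congruenceGL n (γ * γ')).comap f := by
  rw [Subgroup.mem_comap] at hk hk' ⊢
  rw [map_mul, map_mul, map_mul, map_inv, map_inv]
  exact commutator_mem_congruenceGL hk hk'

/-- `⁅K_γ.comap f, K_γ'.comap f⁆ ≤ K_{γγ'}.comap f`. [cite: Casselman1995, §1.4 Prop. 1.4.4] [cite: BernsteinZelevinsky1976, §3] -/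
theorem commutator_comap_congruenceGL_le (γ γ' : ValueGroupWithZero F) :
    ⁅(congruenceGL n γ).comap f, (congruenceGL n γ').comap f⁆ ≤ (congruenceGL n (γ * γ')).comap f :=
  Subgroup.commutator_le.2 fun _ hk _ hk' => by
    rw [commutatorElement_def]
    exact commutator_mem_comap_congruenceGL f hk hk'

/-- Normality along `f`: `κ ∈ GL_n(𝒪).comap f`, `k ∈ K_γ.comap f` ⇒ `κ k κ⁻¹ ∈ K_γ.comap f` (★ `conj_mem_congruenceGL` transported; cf. ★
`inv_mul_mul_mem_comap_congruenceGL_of_mem_glInt` for `U(Φ₃)`). [cite: Casselman1995, §1.4 Prop. 1.4.4] -/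
theorem conj_mem_comap_congruenceGL_of_mem_comap_glInt {γ : ValueGroupWithZero F} {κ k : G} (hκ : κ ∈ (glInt n F).comap f)
    (hk : k ∈ (congruenceGL n γ).comap f) : κ * k * κ⁻¹ ∈ (congruenceGL n γ).comap f := by
  rw [Subgroup.mem_comap] at hκ hk ⊢
  rw [map_mul, map_mul, map_inv]
  exact conj_mem_congruenceGL hκ hk

/-- Normality along `f`, level form: `κ ∈ K_γ.comap f`, `k ∈ K_γ'.comap f` ⇒ `κ k κ⁻¹ ∈ K_γ'.comap f` (ANY `γ, γ'` — the road's «`δ′ ≤ δ → k k′ k⁻¹ ∈ K_δ′`» needs no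
inequality). [cite: Casselman1995, §1.4 Prop. 1.4.4] -/
theorem conj_mem_comap_congruenceGL {γ γ' : ValueGroupWithZero F} {κ k : G} (hκ : κ ∈ (congruenceGL n γ).comap f) (hk : k ∈ (congruenceGL n γ').comap f) :
    κ * k * κ⁻¹ ∈ (congruenceGL n γ').comap f :=
  conj_mem_comap_congruenceGL_of_mem_comap_glInt f (Subgroup.comap_mono (congruenceGL_le_glInt γ) hκ) hk

/-- Along `f`: `∃ c ∈ K_{γγ'}.comap f, k k' k⁻¹ = k' · c` (conjugation moves a level-`γ'` element by a right factor of level `γγ'`). [cite: Casselman1995, §1.4 Prop. 1.4.4] -/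
theorem exists_mem_comap_congruenceGL_conj_eq_mul {γ γ' : ValueGroupWithZero F} {k k' : G} (hk : k ∈ (congruenceGL n γ).comap f)
    (hk' : k' ∈ (congruenceGL n γ').comap f) : ∃ c ∈ (congruenceGL n (γ * γ')).comap f, k * k' * k⁻¹ = k' * c := by
  refine ⟨k'⁻¹ * k * k' * k⁻¹, ?_, by group⟩
  have h := commutator_mem_comap_congruenceGL f (((congruenceGL n γ').comap f).inv_mem hk') hk
  rwa [inv_inv, mul_comm γ' γ] at h

/-- Along `f`, level arithmetic: `γγ' ≤ ε ⇒ ⁅K_γ.comap f, K_γ'.comap f⁆ ≤ K_ε.comap f` (the ABELIAN condition of the sandwich when `γ = γ'`, `γ² ≤ ε`).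
[cite: Casselman1995, §1.4 Prop. 1.4.4] -/
theorem commutator_comap_congruenceGL_le_of_mul_le {γ γ' ε : ValueGroupWithZero F} (h : γ * γ' ≤ ε) :
    ⁅(congruenceGL n γ).comap f, (congruenceGL n γ').comap f⁆ ≤ (congruenceGL n ε).comap f :=
  (commutator_comap_congruenceGL_le f γ γ').trans (Subgroup.comap_mono (congruenceGL_mono h))

/-- Along `f`, elementwise: `γγ' ≤ ε`, `k ∈ K_γ.comap f`, `k' ∈ K_γ'.comap f` ⇒ `k k' k⁻¹ k'⁻¹ ∈ K_ε.comap f`. [cite: Casselman1995, §1.4 Prop. 1.4.4] -/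
theorem commutator_mem_comap_congruenceGL_of_mul_le {γ γ' ε : ValueGroupWithZero F} (h : γ * γ' ≤ ε) {k k' : G}
    (hk : k ∈ (congruenceGL n γ).comap f) (hk' : k' ∈ (congruenceGL n γ').comap f) : k * k' * k⁻¹ * k'⁻¹ ∈ (congruenceGL n ε).comap f :=
  Subgroup.comap_mono (congruenceGL_mono h) (commutator_mem_comap_congruenceGL f hk hk')

/-- `(K_γ.comap f).subgroupOf (GL_n(𝒪).comap f)` is normal. [cite: Casselman1995, §1.4 Prop. 1.4.4] -/
theorem normal_comap_congruenceGL_subgroupOf_comap_glInt (γ : ValueGroupWithZero F) :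
    (((congruenceGL n γ).comap f).subgroupOf ((glInt n F).comap f)).Normal :=
  (Subgroup.normal_subgroupOf_iff (Subgroup.comap_mono (congruenceGL_le_glInt γ))).2 fun _ _ hk hκ =>
    conj_mem_comap_congruenceGL_of_mem_comap_glInt f hκ hk

/-- `(K_γ'.comap f).subgroupOf (K_γ.comap f)` is normal for `γ' ≤ γ`. [cite: Casselman1995, §1.4 Prop. 1.4.4] -/
theorem normal_comap_congruenceGL_subgroupOf {γ γ' : ValueGroupWithZero F} (h : γ' ≤ γ) :
    (((congruenceGL n γ').comap f).subgroupOf ((congruenceGL n γ).comap f)).Normal :=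
  (Subgroup.normal_subgroupOf_iff (Subgroup.comap_mono (congruenceGL_mono h))).2 fun _ _ hk hκ => conj_mem_comap_congruenceGL f hκ hk

/-- Along `f`: `∃ c ∈ K_{γγ'}.comap f, k k' = c · (k' k)`. [cite: Casselman1995, §1.4 Prop. 1.4.4] -/
theorem exists_mem_comap_congruenceGL_mul_eq_mul {γ γ' : ValueGroupWithZero F} {k k' : G} (hk : k ∈ (congruenceGL n γ).comap f)
    (hk' : k' ∈ (congruenceGL n γ').comap f) : ∃ c ∈ (congruenceGL n (γ * γ')).comap f, k * k' = c * (k' * k) :=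
  ⟨k * k' * k⁻¹ * k'⁻¹, commutator_mem_comap_congruenceGL f hk hk', by group⟩

end Transport

end Literature.NumberTheory.Automorphic
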